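import Literature.MathematicalPhysics.QuantumFieldTheory.Balaban1983to89.B9Ineq368L2F
import Literature.MathematicalPhysics.QuantumFieldTheory.Balaban1983to89.B9Ineq368L2MLettersP

/-!
# `Balaban1983to89.B9Ineq368L2FP` — B9 p. 403 (3.68) IN BLOCK-`ℓ²`, THE FOUR ENTRIES OF `F(A) = R₀(U′U) − R₀(U)` WITH THE `C⁻¹` CARRIER GENERIC (a block
# carrier `Y` with block map `blkY`, e.g. NODE 00's `BlkY × ι`), in the shapes `hPp hDPp hPpDs hDPpDs` of `B9Ineq377L2Hom.ineq377_l2_concreteE`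
# (pub-ymgap N06 row 13, G side, `L²` member: brick F2c of the `Read377L2` port)

T. Bałaban, *Propagators for lattice gauge theories in a background field*, Commun. Math. Phys. **99** (1985) 389–434
[`Balaban1985BackgroundPropagators`, "B9"], (3.68) p. 403, (3.57) p. 401, (3.64)–(3.67) pp. 402–403, (3.25) p. 394, (3.48)–(3.49) pp. 398–399, (3.76)–(3.77)
pp. 405–406; [4] = T. Bałaban, *Propagators and renormalization transformations for lattice gauge theories. II*, Commun. Math. Phys. **96** (1984) 223–250
[`Balaban1984PropagatorsII`], Lemma 2.1 p. 234, (2.52)–(2.55) p. 232, Prop. 2.6 (2.140)–(2.141) p. 247.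

statement-level skeleton of published theorems with citation tags; proofs where landed; nothing here is a claim about the Yang–Mills mass gap

WHY THIS FILE (seat dag-n06-c gen 14, READ377L2-PORT-PLAN F2c).  `B9Ineq368L2F.ineq368_l2_F` fixes `C⁻¹` to the scalar carrier; NODE 00's `C⁻¹(V)` is matrix
valued on `BlkY × ι`.  The proof is carrier-agnostic: this file restates it with the middle carrier `Y` (the constants `thetaC thetaI thetaM kappa368F` are
g6's, used by name; the bricks are the `P` twins `B9Ineq349L2ReadingsP.hasL2Majorant_QcsCQc_of_readingsP`, `B9Ineq368L2MLettersP.*`).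

HONEST SCOPE.  Finite-dimensional bookkeeping; every letter a binder with its reading as hypothesis; nothing of [B9] asserted for Bałaban's operators;
count-neutral; NOT a node discharge; nothing continuum ∕ OS ∕ mass-gap ∕ Clay.  Cell `pub-ymgap` (HUMAN RULING D-0062), Track A node N06 [B9], row 13, 2026-08-29.
-/

noncomputable section

open scoped BigOperators

namespace Literature.MathematicalPhysics.QuantumFieldTheory.Balaban1983to89.B9Ineq368L2FP

open B6RandomWalk (Triangle254 Ineq261)
open B6RandomWalkL2 (HasL2Majorant hasL2Majorant_mono)
open B6RandomWalkL2Hom (HasL2MajorantHom hasL2MajorantHom_mono)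
open B9Thm34Ext (toB6)
open B9Ineq347 (ScaleTransfer)
open B9Ineq363L2 (hasL2Majorant_rate_mono)
open B9Ineq377L2 (hasL2Majorant_comp_decay_left1 hasL2Majorant_comp_decay_right1)
open B9Ineq368PPrime (scaleTransfer_const_mono)
open B9Ineq366CPrime (scaleTransfer_one)
open B9Eq352DivFormLetters (conj)
open B9Eq352GradLetters (diffLetter)
open B9Eq376POneLetters (conjHom gradLin divLin)
open B9Eq376L2DerivDict (hasL2MajorantHom_gradLin_comp hasL2MajorantHom_comp_divLin hasL2Majorant_gradLin_comp_comp_divLin)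
open B9Ineq368L2RZero (ineq368_l2_word)
open B9Ineq368L2F (thetaC thetaI thetaM kappa368F)
open B9Ineq349L2ReadingsP (hasL2Majorant_QcsCQc_of_readingsP)
open B9Ineq368L2MLettersP (hasL2Majorant_cDiff_sitesP hasL2Majorant_copDiff_sitesP hasL2Majorant_mDiff_of_readingsP)

section Assembly

variable {𝔸 : Type*} [NormedRing 𝔸] [NormedAlgebra ℂ 𝔸] {ι : Type} [Fintype ι]
variable (b : Module.Basis ι ℝ 𝔸) {S : Type} [Fintype S] {κ : Type} [Fintype κ]
variable (T : κ → Equiv.Perm S) (U : κ → S → 𝔸ˣ)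
variable {g : B9.Geometry} [Fintype g.Site] [DecidableEq g.Site] {R : ℝ} {H : Prop} {Y : Type} [Fintype Y]

set_option maxHeartbeats 1600000 in
/-- ★★ **(3.68) IN BLOCK-`ℓ²`, THE FOUR ENTRIES OF `F(A) = R₀(U′U) − R₀(U)` FROM THE LETTERS, `C⁻¹` CARRIER GENERIC** (g6's `B9Ineq368L2F.ineq368_l2_F` with the
lattice of blocks replaced by a block carrier `Y`, block map `blkY`, and the (3.48) entry bounds by block-`ℓ²` majorants on `Y`; same proof), in the shapes `hPp`, `hDPp`, `hPpDs`, `hDPpDs` of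
`B9Ineq377L2Hom.ineq377_l2_concreteE` (constant `(1 + #κ)·κ₃₆₈ᶠ·α₁`, rate `(21/25)δ`), with `R₀(V) = G′(V) ∘ Q′*(V) ∘ C⁻¹(V) ∘ Q′(V) ∘ G′(V)` typed through 𝔅.
See the module header for the inputs; route: small differences `X(G̃ − G) = (XG̃)(V′G)`, `(G̃ − G)Y = (GV′)(G̃Y)` by the resolvent identities and one
composition each; `M, M′` by `B9Ineq349L2Readings.hasL2Majorant_QcsCQc_of_readings`; `M′ − M` by `B9Ineq368L2MLetters` ((3.66)–(3.67) on 𝔅); the words by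
`B9Ineq368L2RZero.ineq368_l2_word`; the two-carrier shapes by `B9Eq376L2DerivDict`.  (One long assembly of a dozen bricks in a single
theorem: the heartbeat limit is raised for it, twice the lineage's usual figure.)
[cite: Balaban1985BackgroundPropagators, (3.68) p.403 + (3.57) p.402 + (3.64)–(3.67) pp.402–403 + (3.25) p.394 + (3.48)–(3.49) pp.398–399 + (3.76)–(3.77) pp.405–406; Balaban1984PropagatorsII, Lemma 2.1 p.234 + (2.52)–(2.55) p.232 + Prop. 2.6 (2.140)–(2.141) p.247] -/
theorem ineq368_l2_FP (blk : S → g.Site) (blkY : Y → g.Site) (d : ℕ) (c' : ℂ) (δ BG θV θW κc κs θc θs B₁ B₁' α₁ : ℝ) (Λf ΛCf : ℝ → ℝ) (wc ws : g.Site → ℝ)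
    (hδ : 0 < δ) (hBG : 0 ≤ BG) (hθV : 0 ≤ θV) (hθW : 0 ≤ θW) (hκc : 0 ≤ κc) (hκs : 0 ≤ κs) (hθc : 0 ≤ θc) (hθs : 0 ≤ θs) (hB₁ : 0 ≤ B₁)
    (hB₁' : 0 ≤ B₁') (hα₁ : 0 ≤ α₁) (hΛf : ∀ α : ℝ, 0 < α → 1 ≤ Λf α) (hΛCf : ∀ α : ℝ, 0 ≤ ΛCf α)
    (hwc : ∀ a, 0 ≤ wc a) (hws : ∀ a, 0 ≤ ws a) (hprod : ∀ a, ws a * wc a ≤ 1)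
    (hdnn : ∀ a a' : g.Site, 0 ≤ g.dist a a') (hsym : ∀ a a' : g.Site, g.dist a a' = g.dist a' a) (htri : Triangle254 (toB6 g R H))
    (hlen : ∀ y : g.Site, 0 < g.len y)
    -- [4] Lemma 2.1 at the rate `δ`, uniform in the exponent window; the volume transfer of `w_c` likewise
    (h261 : ∀ α : ℝ, 9 / 5000 ≤ α → α < 1 → Ineq261 d (toB6 g R H) δ α)
    (hST : ∀ α : ℝ, 9 / 5000 ≤ α →
      ScaleTransfer g δ α (Λf α) (fun a => g.len a) ∧ ScaleTransfer g δ α (Λf α) (fun a => g.len a ^ 2) ∧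
      ScaleTransfer g δ α (Λf α) (fun a => (g.len a ^ 4)⁻¹))
    (hTC : ∀ α : ℝ, 9 / 5000 ≤ α → ∀ a a' : g.Site, Real.exp (-(α * δ * g.dist a a')) * wc a' ≤ ΛCf α * wc a)
    -- the letters: `G = G′(U)`, `G̃ = G′(U′U)`, `V′ = V′(A)`, `Q′, Q′*` at U (no index) and at U′U (index 1), `C⁻¹` at U and U′U on 𝔅
    {G Gt Vp : Module.End ℝ (S × ι → ℝ)}
    {Qc Qc₁ : (S × ι → ℝ) →ₗ[ℝ] (Y → ℝ)} {Qcs Qcs₁ : (Y → ℝ) →ₗ[ℝ] (S × ι → ℝ)} {Cop Cop₁ : Module.End ℝ (Y → ℝ)}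
    -- (3.65): the resolvent identities of the extension
    (h365 : Gt = G + Gt * (Vp * G)) (h365' : Gt = G + G * (Vp * Gt))
    -- Theorem 3.1's block-ℓ² members 0, 1, 2 of `G′(U)` and of `G′(U′U)` per directional letter, common constant `B_G`, rate `δ`
    (hG0 : HasL2Majorant (g := toB6 g R H) (fun p : S × ι => blk p.1) G (fun a a' => BG * g.len a ^ 2 * Real.exp (-(δ * g.dist a a'))))
    (hG1 : ∀ μ : κ, HasL2Majorant (g := toB6 g R H) (fun p : S × ι => blk p.1) (conj b (diffLetter T U c' (Sum.inl μ)) * G)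
      (fun a a' => BG * g.len a * Real.exp (-(δ * g.dist a a'))))
    (hGt0 : HasL2Majorant (g := toB6 g R H) (fun p : S × ι => blk p.1) Gt (fun a a' => BG * g.len a ^ 2 * Real.exp (-(δ * g.dist a a'))))
    (hGt1 : ∀ μ : κ, HasL2Majorant (g := toB6 g R H) (fun p : S × ι => blk p.1) (conj b (diffLetter T U c' (Sum.inl μ)) * Gt)
      (fun a a' => BG * g.len a * Real.exp (-(δ * g.dist a a'))))
    (hGt2 : ∀ ν : κ, HasL2Majorant (g := toB6 g R H) (fun p : S × ι => blk p.1) (Gt * conj b (diffLetter T U c' (Sum.inr ν)))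
      (fun a a' => BG * g.len a * Real.exp (-(δ * g.dist a a'))))
    -- the block-ℓ² (3.63) and its right twin
    (hVG : HasL2Majorant (g := toB6 g R H) (fun p : S × ι => blk p.1) (Vp * G) (fun a a' => θV * α₁ * Real.exp (-(δ * g.dist a a'))))
    (hGV : HasL2Majorant (g := toB6 g R H) (fun p : S × ι => blk p.1) (G * Vp) (fun a a' => θW * α₁ * Real.exp (-(δ * g.dist a a'))))
    -- structured Hom-readings of `Q′, Q′*` at U and U′U and of the (3.57) variations
    (hQc : HasL2MajorantHom (g := toB6 g R H) (fun p : S × ι => blk p.1) blkY Qc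
      (fun a a' : g.Site => if a = a' then κc * wc a else 0))
    (hQc₁ : HasL2MajorantHom (g := toB6 g R H) (fun p : S × ι => blk p.1) blkY Qc₁
      (fun a a' : g.Site => if a = a' then κc * wc a else 0))
    (hQcs : HasL2MajorantHom (g := toB6 g R H) blkY (fun p : S × ι => blk p.1) Qcs
      (fun a a' : g.Site => if a = a' then κs * ws a else 0))
    (hQcs₁ : HasL2MajorantHom (g := toB6 g R H) blkY (fun p : S × ι => blk p.1) Qcs₁
      (fun a a' : g.Site => if a = a' then κs * ws a else 0))
    (hFc : HasL2MajorantHom (g := toB6 g R H) (fun p : S × ι => blk p.1) blkY (Qc₁ - Qc)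
      (fun a a' : g.Site => if a = a' then θc * α₁ * wc a else 0))
    (hFcs : HasL2MajorantHom (g := toB6 g R H) blkY (fun p : S × ι => blk p.1) (Qcs₁ - Qcs)
      (fun a a' : g.Site => if a = a' then θs * α₁ * ws a else 0))
    -- the (3.48) ENTRY bounds of `C⁻¹` on 𝔅 at U and at U′U, and the inverse laws
    (h348 : HasL2Majorant (g := toB6 g R H) blkY Cop (fun a a' => B₁ * (g.len a ^ 4)⁻¹ * Real.exp (-(δ * g.dist a a'))))
    (h348' : HasL2Majorant (g := toB6 g R H) blkY Cop₁ (fun a a' => B₁' * (g.len a ^ 4)⁻¹ * Real.exp (-(δ * g.dist a a'))))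
    (hinv : (Qc ∘ₗ (G * G) ∘ₗ Qcs) * Cop = 1) (hinv₁ : Cop₁ * (Qc₁ ∘ₗ (Gt * Gt) ∘ₗ Qcs₁) = 1) :
    let K : ℝ := (1 + Fintype.card κ) *
      kappa368F (Λf (1 / 100)) (B6.c1 d δ (1 / 100)) (ΛCf (1 / 100)) (ΛCf (1 / 100 * (48 / 50))) (ΛCf (1 / 100 * (45 / 50)))
        κc κs θc θs BG θV θW B₁ B₁'
    HasL2Majorant (g := toB6 g R H) (fun p : S × ι => blk p.1) (Gt ∘ₗ Qcs₁ ∘ₗ Cop₁ ∘ₗ Qc₁ ∘ₗ Gt - G ∘ₗ Qcs ∘ₗ Cop ∘ₗ Qc ∘ₗ G)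
        (fun a a' => K * α₁ * Real.exp (-(21 / 25 * δ * g.dist a a'))) ∧
      HasL2MajorantHom (g := toB6 g R H) (fun p : S × ι => blk p.1) (fun q : (κ × S) × ι => blk q.1.2)
        (conjHom b (gradLin T c' U) ∘ₗ (Gt ∘ₗ Qcs₁ ∘ₗ Cop₁ ∘ₗ Qc₁ ∘ₗ Gt - G ∘ₗ Qcs ∘ₗ Cop ∘ₗ Qc ∘ₗ G))
        (fun a a' => K * α₁ * (g.len a)⁻¹ * Real.exp (-(21 / 25 * δ * g.dist a a'))) ∧
      HasL2MajorantHom (g := toB6 g R H) (fun q : (κ × S) × ι => blk q.1.2) (fun p : S × ι => blk p.1)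
        ((Gt ∘ₗ Qcs₁ ∘ₗ Cop₁ ∘ₗ Qc₁ ∘ₗ Gt - G ∘ₗ Qcs ∘ₗ Cop ∘ₗ Qc ∘ₗ G) ∘ₗ conjHom b (divLin T c' U))
        (fun a a' => K * α₁ * (g.len a)⁻¹ * Real.exp (-(21 / 25 * δ * g.dist a a'))) ∧
      HasL2Majorant (g := toB6 g R H) (fun q : (κ × S) × ι => blk q.1.2)
        (conjHom b (gradLin T c' U) ∘ₗ (Gt ∘ₗ Qcs₁ ∘ₗ Cop₁ ∘ₗ Qc₁ ∘ₗ Gt - G ∘ₗ Qcs ∘ₗ Cop ∘ₗ Qc ∘ₗ G) ∘ₗ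
          conjHom b (divLin T c' U))
        (fun a a' => K * α₁ * (g.len a ^ 2)⁻¹ * Real.exp (-(21 / 25 * δ * g.dist a a'))) := by
  intro K
  letI : DecidableEq (toB6 g R H).Site := ‹DecidableEq g.Site›
  -- abbreviations: Lemma-2.1 constants, the volume transfers, the rate ladder `r_k = (1 − k/50)δ`
  set Λ : ℝ := Λf (1 / 100) with hΛ_def
  set c : ℝ := B6.c1 d δ (1 / 100) with hc_def
  set Λ0 : ℝ := ΛCf (1 / 100) with hΛ0
  set Λ2 : ℝ := ΛCf (1 / 100 * (48 / 50)) with hΛ2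
  set Λ5 : ℝ := ΛCf (1 / 100 * (45 / 50)) with hΛ5
  have hΛ1 : 1 ≤ Λ := hΛf _ (by norm_num)
  have hΛ0' : 0 ≤ Λ := zero_le_one.trans hΛ1
  have hc0 : 0 ≤ c := B6RandomWalk.c1_nonneg _ _ _
  have hΛ00 : 0 ≤ Λ0 := hΛCf _
  have hΛ20 : 0 ≤ Λ2 := hΛCf _
  have hΛ50 : 0 ≤ Λ5 := hΛCf _
  have hδ0 : 0 ≤ δ := hδ.le
  set r1 : ℝ := 49 / 50 * δ with hr1
  set r2 : ℝ := 48 / 50 * δ with hr2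
  set r3 : ℝ := 47 / 50 * δ with hr3
  set r4 : ℝ := 46 / 50 * δ with hr4
  set r5 : ℝ := 45 / 50 * δ with hr5
  set r6 : ℝ := 44 / 50 * δ with hr6
  set r8 : ℝ := 42 / 50 * δ with hr8
  have hr10 : 0 ≤ r1 := by positivity
  have hr20 : 0 ≤ r2 := by positivity
  have hr40 : 0 ≤ r4 := by positivity
  have hr50 : 0 ≤ r5 := by positivity
  have hr80 : 0 ≤ r8 := by positivity
  have hw2 : ∀ a : g.Site, 0 ≤ g.len a ^ 2 := fun a => sq_nonneg _
  have hw1 : ∀ a : g.Site, 0 ≤ g.len a := fun a => (hlen a).le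
  have hw4i : ∀ a : g.Site, 0 ≤ (g.len a ^ 4)⁻¹ := fun a => inv_nonneg.mpr (by positivity)
  have hw0 : ∀ _a : g.Site, 0 ≤ (1 : ℝ) := fun _ => zero_le_one
  -- Lemma 2.1 and the transfers at `δ`, exponent 1/100
  have h261β : Ineq261 d (toB6 g R H) δ (1 / 100) := h261 _ (by norm_num) (by norm_num)
  obtain ⟨hT1, hT2, hT4⟩ := hST (1 / 100) (by norm_num)
  have hT0 : ScaleTransfer g δ (1 / 100) Λ (fun _ => (1 : ℝ)) :=
    scaleTransfer_const_mono hw0 hΛ1 (scaleTransfer_one (by positivity) hdnn)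
  have hTC0 : ∀ a a' : g.Site, Real.exp (-(1 / 100 * δ * g.dist a a')) * wc a' ≤ Λ0 * wc a := hTC (1 / 100) (by norm_num)
  have hTC2 : ∀ a a' : g.Site, Real.exp (-(1 / 100 * r2 * g.dist a a')) * wc a' ≤ Λ2 * wc a := by
    intro a a'
    have h := hTC (1 / 100 * (48 / 50)) (by norm_num) a a'
    have e : 1 / 100 * (48 / 50) * δ = 1 / 100 * r2 := by rw [hr2]; ring
    rwa [e] at h
  have hTC5 : ∀ a a' : g.Site, Real.exp (-(1 / 100 * r5 * g.dist a a')) * wc a' ≤ Λ5 * wc a := by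
    intro a a'
    have h := hTC (1 / 100 * (45 / 50)) (by norm_num) a a'
    have e : 1 / 100 * (45 / 50) * δ = 1 / 100 * r5 := by rw [hr5]; ring
    rwa [e] at h
  -- rate lowering helper
  have low := fun {X : Type} [Fintype X] (bl : X → g.Site) (A : ℝ) (w : g.Site → ℝ) (hA : 0 ≤ A) (hw : ∀ a, 0 ≤ w a) {ρ r : ℝ}
      (h : ρ ≤ r) {T₀ : Module.End ℝ (X → ℝ)}
      (hT : HasL2Majorant (g := toB6 g R H) bl T₀ (fun a a' => A * w a * Real.exp (-(r * g.dist a a')))) =>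
    hasL2Majorant_rate_mono (R := R) (H := H) bl A w hA hw h hdnn hT
  -- §A  the small differences `X(G̃ − G) = (XG̃)(V′G)`, `(G̃ − G)Y = (GV′)(G̃Y)` at the rate r1
  have hdiff : Gt - G = Gt * (Vp * G) := sub_eq_iff_eq_add'.mpr h365
  have hdiff' : Gt - G = G * (Vp * Gt) := sub_eq_iff_eq_add'.mpr h365'
  have eX : ∀ X : Module.End ℝ (S × ι → ℝ), X * (Gt - G) = X * Gt * (Vp * G) := fun X => by
    rw [hdiff]; simp only [mul_assoc]
  have eY : ∀ Y : Module.End ℝ (S × ι → ℝ), (Gt - G) * Y = G * Vp * (Gt * Y) := fun Y => by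
    rw [hdiff']; simp only [mul_assoc]
  have hr1δ : r1 + (1 / 100 + 1 / 100) * δ ≤ δ := by rw [hr1]; linarith
  have hr1le : r1 ≤ δ := by rw [hr1]; linarith
  have hVG1 : HasL2Majorant (g := toB6 g R H) (fun p : S × ι => blk p.1) (Vp * G)
      (fun a a' => θV * α₁ * Real.exp (-(r1 * g.dist a a'))) :=
    hasL2Majorant_mono (g := toB6 g R H) _ hVG fun a a' =>
      mul_le_mul_of_nonneg_left (Real.exp_le_exp.2 (neg_le_neg (mul_le_mul_of_nonneg_right hr1le (hdnn a a')))) (mul_nonneg hθV hα₁)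
  -- X = 1 (weight ℓ²) and X = ∇_μ (weight ℓ)
  have hd0 : HasL2Majorant (g := toB6 g R H) (fun p : S × ι => blk p.1) (1 * (Gt - G))
      (fun a a' => (BG * (θV * α₁) * c) * g.len a ^ 2 * Real.exp (-(r1 * g.dist a a'))) := by
    rw [eX]
    exact hasL2Majorant_comp_decay_right1 (R := R) (H := H) _ d δ (1 / 100) (1 / 100) r1 δ BG (θV * α₁) (fun a => g.len a ^ 2) hw2 hBG
      (mul_nonneg hθV hα₁) hr10 (by positivity) hr1δ hdnn htri h261β (by rw [one_mul]; exact hGt0) hVG1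
  have hd1 : ∀ μ : κ, HasL2Majorant (g := toB6 g R H) (fun p : S × ι => blk p.1) (conj b (diffLetter T U c' (Sum.inl μ)) * (Gt - G))
      (fun a a' => (BG * (θV * α₁) * c) * g.len a * Real.exp (-(r1 * g.dist a a'))) := by
    intro μ
    rw [eX]
    exact hasL2Majorant_comp_decay_right1 (R := R) (H := H) _ d δ (1 / 100) (1 / 100) r1 δ BG (θV * α₁) (fun a => g.len a) hw1 hBG
      (mul_nonneg hθV hα₁) hr10 (by positivity) hr1δ hdnn htri h261β (hGt1 μ) hVG1
  -- Y = 1 (weight ℓ²) and Y = ∇♯_ν (weight ℓ)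
  have hGt0r := low (fun p : S × ι => blk p.1) BG (fun a => g.len a ^ 2) hBG hw2 hr1le hGt0
  have hGt2r := fun ν => low (fun p : S × ι => blk p.1) BG (fun a => g.len a) hBG hw1 hr1le (hGt2 ν)
  have he0 : HasL2Majorant (g := toB6 g R H) (fun p : S × ι => blk p.1) ((Gt - G) * 1)
      (fun a a' => (θW * α₁ * BG * Λ * c) * g.len a ^ 2 * Real.exp (-(r1 * g.dist a a'))) := by
    rw [eY]
    exact hasL2Majorant_comp_decay_left1 (R := R) (H := H) _ d δ (1 / 100) (1 / 100) r1 δ Λ (θW * α₁) BG (fun a => g.len a ^ 2) hw2 hΛ0'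
      (mul_nonneg hθW hα₁) hBG hr10 hr1δ hdnn htri hT2 h261β hGV (by rw [mul_one]; exact hGt0r)
  have he2 : ∀ ν : κ, HasL2Majorant (g := toB6 g R H) (fun p : S × ι => blk p.1) ((Gt - G) * conj b (diffLetter T U c' (Sum.inr ν)))
      (fun a a' => (θW * α₁ * BG * Λ * c) * g.len a * Real.exp (-(r1 * g.dist a a'))) := by
    intro ν
    rw [eY]
    exact hasL2Majorant_comp_decay_left1 (R := R) (H := H) _ d δ (1 / 100) (1 / 100) r1 δ Λ (θW * α₁) BG (fun a => g.len a) hw1 hΛ0'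
      (mul_nonneg hθW hα₁) hBG hr10 hr1δ hdnn htri hT1 h261β hGV (hGt2r ν)
  -- §B  the sandwiched letters `M`, `M′` at the rate r1
  set BM : ℝ := κs * κc * B₁ * Λ0 with hBM
  set BM' : ℝ := κs * κc * B₁' * Λ0 with hBM'
  have hBM0 : 0 ≤ BM := by positivity
  have hBM'0 : 0 ≤ BM' := by positivity
  have hr1C : r1 ≤ (1 - 1 / 100) * δ := by rw [hr1]; linarith
  have hM := hasL2Majorant_QcsCQc_of_readingsP (R := R) (H := H) (fun p : S × ι => blk p.1) blkY r1 δ (1 / 100) Λ0 κc κs B₁ wc ws hκc hκs hB₁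
    hΛ00 hws hprod hr1C hdnn hTC0 hQc hQcs h348
  have hM' := hasL2Majorant_QcsCQc_of_readingsP (R := R) (H := H) (fun p : S × ι => blk p.1) blkY r1 δ (1 / 100) Λ0 κc κs B₁' wc ws hκc hκs hB₁'
    hΛ00 hws hprod hr1C hdnn hTC0 hQc₁ hQcs₁ h348'
  -- §C  (3.66) on 𝔅: `C(U′U) − C(U)` at the rate r3
  set θG : ℝ := BG * (θV * α₁) * c with hθG
  have hθG0 : 0 ≤ θG := by positivity
  have hG0r := low (fun p : S × ι => blk p.1) BG (fun a => g.len a ^ 2) hBG hw2 hr1le hG0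
  have hd0' : HasL2Majorant (g := toB6 g R H) (fun p : S × ι => blk p.1) (Gt - G)
      (fun a a' => θG * g.len a ^ 2 * Real.exp (-(r1 * g.dist a a'))) := by
    rw [hθG]; simpa only [one_mul] using hd0
  have hr2r1 : r2 + (1 / 100 + 1 / 100) * δ ≤ r1 := by rw [hr1, hr2]; linarith
  have hC' := hasL2Majorant_cDiff_sitesP (R := R) (H := H) (fun p : S × ι => blk p.1) blkY d δ r1 (1 / 100) (1 / 100) r2 Λ (1 / 100) Λ2 κc κs
    (θc * α₁) (θs * α₁) BG θG wc ws hκc hκs (mul_nonneg hθc hα₁) (mul_nonneg hθs hα₁) hBG hθG0 hΛ0' hΛ20 hr20 (by norm_num) (by norm_num)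
    hδ0 hr2r1 hwc hws hprod hdnn hsym htri h261β hT2 hTC2 hQc hQcs₁ hFc hFcs hG0r hGt0r hd0'
  set KC : ℝ := Λ2 * (Λ * c) * (θc * α₁ * κs * (BG * BG) + κc * κs * (θG * BG + BG * θG) + κc * (θs * α₁) * (BG * BG)) with hKC
  have hKC0 : 0 ≤ KC := by positivity
  have hw4 : ∀ a : g.Site, 0 ≤ g.len a ^ 4 := fun a => by positivity
  have hC3 : HasL2Majorant (g := toB6 g R H) blkY (Qc₁ ∘ₗ (Gt * Gt) ∘ₗ Qcs₁ - Qc ∘ₗ (G * G) ∘ₗ Qcs)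
      (fun a a' => KC * g.len a ^ 4 * Real.exp (-(r3 * g.dist a a'))) :=
    low blkY KC (fun a => g.len a ^ 4) hKC0 hw4 (show r3 ≤ (1 - 1 / 100) * r2 by rw [hr2, hr3]; linarith) hC'
  -- §D  (3.67) on 𝔅: `C⁻¹(U′U) − C⁻¹(U)` at the rate r5
  have hr3le : r3 ≤ δ := by rw [hr3]; linarith
  have h348r := low blkY B₁ (fun a => (g.len a ^ 4)⁻¹) hB₁ hw4i hr3le h348
  have h348r' := low blkY B₁' (fun a => (g.len a ^ 4)⁻¹) hB₁' hw4i hr3le h348'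
  have hr4r3 : r4 + (1 / 100 + 1 / 100) * δ ≤ r3 := by rw [hr3, hr4]; linarith
  have hr5r4 : r5 + (1 / 100 + 1 / 100) * δ ≤ r4 := by rw [hr4, hr5]; linarith
  have hI := hasL2Majorant_copDiff_sitesP (R := R) (H := H) blkY d δ r3 (1 / 100) (1 / 100) r4 r5 Λ B₁ B₁' KC hB₁ hB₁' hKC0 hΛ0' hr40 hr50
    (by norm_num) (by norm_num) hδ0 hr4r3 hr5r4 hdnn htri hlen h261β hT4 (C := Qc ∘ₗ (G * G) ∘ₗ Qcs) (C₁ := Qc₁ ∘ₗ (Gt * Gt) ∘ₗ Qcs₁)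
    (Cop := Cop) (Cop₁ := Cop₁) hinv hinv₁ h348r h348r' hC3
  set KI : ℝ := 1 * B6.c1 d δ (1 / 100) * B₁' * (Λ * B6.c1 d δ (1 / 100) * KC * B₁) with hKI
  have hKI0 : 0 ≤ KI := by positivity
  -- §E  the small sandwiched letter `M′ − M` at the rate r6
  have hr5le : r5 ≤ δ := by rw [hr5]; linarith
  have hdM' := hasL2Majorant_mDiff_of_readingsP (R := R) (H := H) (fun p : S × ι => blk p.1) blkY r5 δ (1 / 100) Λ5 κc κs (θc * α₁) (θs * α₁) B₁ KI
    wc ws hκc hκs (mul_nonneg hθc hα₁) (mul_nonneg hθs hα₁) hB₁ hKI0 hΛ50 hr5le hws hprod hdnn hTC5 hQc₁ hQcs hQcs₁ hFc hFcs h348 hI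
  set KM : ℝ := Λ5 * (κs * κc * KI + θs * α₁ * κc * B₁ + κs * (θc * α₁) * B₁) with hKM
  have hKM0 : 0 ≤ KM := by positivity
  have hdM : HasL2Majorant (g := toB6 g R H) (fun p : S × ι => blk p.1) (Qcs₁ ∘ₗ Cop₁ ∘ₗ Qc₁ - Qcs ∘ₗ Cop ∘ₗ Qc)
      (fun a a' => KM * (g.len a ^ 4)⁻¹ * Real.exp (-(r6 * g.dist a a'))) :=
    low (fun p : S × ι => blk p.1) KM (fun a => (g.len a ^ 4)⁻¹) hKM0 hw4i (show r6 ≤ (1 - 1 / 100) * r5 by rw [hr5, hr6]; linarith) hdM'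
  -- §F  the words at the common rate r6, output r8
  have hr6le : r6 ≤ δ := by rw [hr6]; linarith
  have hr6r1 : r6 ≤ r1 := by rw [hr1, hr6]; linarith
  have hG0w := low (fun p : S × ι => blk p.1) BG (fun a => g.len a ^ 2) hBG hw2 hr6le hG0
  have hG1w := fun μ => low (fun p : S × ι => blk p.1) BG (fun a => g.len a) hBG hw1 hr6le (hG1 μ)
  have hGt0w := low (fun p : S × ι => blk p.1) BG (fun a => g.len a ^ 2) hBG hw2 hr6le hGt0
  have hGt2w := fun ν => low (fun p : S × ι => blk p.1) BG (fun a => g.len a) hBG hw1 hr6le (hGt2 ν)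
  have hd0w := low (fun p : S × ι => blk p.1) (BG * (θV * α₁) * c) (fun a => g.len a ^ 2) (by positivity) hw2 hr6r1 hd0
  have hd1w := fun μ => low (fun p : S × ι => blk p.1) (BG * (θV * α₁) * c) (fun a => g.len a) (by positivity) hw1 hr6r1 (hd1 μ)
  have he0w := low (fun p : S × ι => blk p.1) (θW * α₁ * BG * Λ * c) (fun a => g.len a ^ 2) (by positivity) hw2 hr6r1 he0
  have he2w := fun ν => low (fun p : S × ι => blk p.1) (θW * α₁ * BG * Λ * c) (fun a => g.len a) (by positivity) hw1 hr6r1 (he2 ν)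
  have hMw := low (fun p : S × ι => blk p.1) BM (fun a => (g.len a ^ 4)⁻¹) hBM0 hw4i hr6r1 hM
  have hM'w := low (fun p : S × ι => blk p.1) BM' (fun a => (g.len a ^ 4)⁻¹) hBM'0 hw4i hr6r1 hM'
  have hr8r6 : r8 + (2 * (1 / 100) + 1 / 100) * δ ≤ r6 := by rw [hr6, hr8]; linarith
  -- the word lemma for the outer letters X ∈ {1, ∇_μ}, Y ∈ {1, ∇♯_ν}
  have word := fun {X Y : Module.End ℝ (S × ι → ℝ)} (wX wY : g.Site → ℝ) (hwX : ∀ a, 0 ≤ wX a) (hwY : ∀ a, 0 ≤ wY a)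
      (hTY : ScaleTransfer g δ (1 / 100) Λ wY)
      (hXG : HasL2Majorant (g := toB6 g R H) (fun p : S × ι => blk p.1) (X * G) (fun a b => BG * wX a * Real.exp (-(r6 * g.dist a b))))
      (hXd : HasL2Majorant (g := toB6 g R H) (fun p : S × ι => blk p.1) (X * (Gt - G))
        (fun a b => (BG * (θV * α₁) * c) * wX a * Real.exp (-(r6 * g.dist a b))))
      (hGtY : HasL2Majorant (g := toB6 g R H) (fun p : S × ι => blk p.1) (Gt * Y) (fun a b => BG * wY a * Real.exp (-(r6 * g.dist a b))))
      (hdY : HasL2Majorant (g := toB6 g R H) (fun p : S × ι => blk p.1) ((Gt - G) * Y)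
        (fun a b => (θW * α₁ * BG * Λ * c) * wY a * Real.exp (-(r6 * g.dist a b)))) =>
    ineq368_l2_word (R := R) (H := H) (fun p : S × ι => blk p.1) d δ r6 (1 / 100) (1 / 100) r8 Λ BG BG BM BM' (BG * (θV * α₁) * c)
      (θW * α₁ * BG * Λ * c) KM wX wY hwX hwY hBG hBG hBM0 hBM'0 (by positivity) (by positivity) hKM0 hΛ1 hr80 (by norm_num) (by norm_num) hδ0
      hr8r6 hdnn htri h261β hTY hT4 (M := Qcs ∘ₗ Cop ∘ₗ Qc) (M' := Qcs₁ ∘ₗ Cop₁ ∘ₗ Qc₁) hXG hXd hGtY hdY hMw hM'w hdM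
  -- the R-words as products
  have eF : Gt ∘ₗ Qcs₁ ∘ₗ Cop₁ ∘ₗ Qc₁ ∘ₗ Gt - G ∘ₗ Qcs ∘ₗ Cop ∘ₗ Qc ∘ₗ G
      = Gt * (Qcs₁ ∘ₗ Cop₁ ∘ₗ Qc₁) * Gt - G * (Qcs ∘ₗ Cop ∘ₗ Qc) * G := rfl
  set KF : ℝ := Λ ^ 4 * B6.c1 d δ (1 / 100) ^ 2 *
    ((BG * (θV * α₁) * c) * BM' * BG + BG * KM * BG + BG * BM * (θW * α₁ * BG * Λ * c)) with hKF
  have hKF0 : 0 ≤ KF := by positivity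
  -- `KF = K/(1+#κ) · α₁`: every small input carries one `α₁`
  have hKFK : KF = kappa368F (Λf (1 / 100)) (B6.c1 d δ (1 / 100)) (ΛCf (1 / 100)) (ΛCf (1 / 100 * (48 / 50))) (ΛCf (1 / 100 * (45 / 50)))
      κc κs θc θs BG θV θW B₁ B₁' * α₁ := by
    rw [hKF, hKM, hKI, hKC, hθG, hBM, hBM', kappa368F, thetaM, thetaI, thetaC, hΛ_def, hc_def, hΛ0, hΛ2, hΛ5]
    ring
  have hcard : (0 : ℝ) ≤ Fintype.card κ := Nat.cast_nonneg _
  set K₀ : ℝ := kappa368F (Λf (1 / 100)) (B6.c1 d δ (1 / 100)) (ΛCf (1 / 100)) (ΛCf (1 / 100 * (48 / 50))) (ΛCf (1 / 100 * (45 / 50)))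
      κc κs θc θs BG θV θW B₁ B₁' with hK₀
  have hK₀α : 0 ≤ K₀ * α₁ := by rw [← hKFK]; exact hKF0
  have hKdef : K = (1 + Fintype.card κ) * K₀ := rfl
  have hsq : Real.sqrt (Fintype.card κ) ≤ 1 + Fintype.card κ :=
    calc Real.sqrt (Fintype.card κ) ≤ Real.sqrt ((1 + Fintype.card κ) ^ 2) := Real.sqrt_le_sqrt (by nlinarith)
      _ = 1 + Fintype.card κ := Real.sqrt_sq (by linarith)
  have hsq0 : 0 ≤ Real.sqrt (Fintype.card κ) := Real.sqrt_nonneg _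
  have hK1 : KF ≤ K * α₁ := by
    rw [hKFK, hKdef]
    have h1 : (1 : ℝ) ≤ 1 + Fintype.card κ := le_add_of_nonneg_right hcard
    calc K₀ * α₁ = 1 * (K₀ * α₁) := (one_mul _).symm
      _ ≤ (1 + Fintype.card κ) * (K₀ * α₁) := mul_le_mul_of_nonneg_right h1 hK₀α
      _ = (1 + Fintype.card κ) * K₀ * α₁ := by ring
  have hKs : Real.sqrt (Fintype.card κ) * KF ≤ K * α₁ := by
    rw [hKFK, hKdef]
    calc Real.sqrt (Fintype.card κ) * (K₀ * α₁) ≤ (1 + Fintype.card κ) * (K₀ * α₁) := mul_le_mul_of_nonneg_right hsq hK₀α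
      _ = (1 + Fintype.card κ) * K₀ * α₁ := by ring
  have hKc : (Fintype.card κ : ℝ) * KF ≤ K * α₁ := by
    rw [hKFK, hKdef]
    have h1 : (Fintype.card κ : ℝ) ≤ 1 + Fintype.card κ := le_add_of_nonneg_left zero_le_one
    calc (Fintype.card κ : ℝ) * (K₀ * α₁) ≤ (1 + Fintype.card κ) * (K₀ * α₁) := mul_le_mul_of_nonneg_right h1 hK₀α
      _ = (1 + Fintype.card κ) * K₀ * α₁ := by ring
  -- §G  the four words and their shapes
  set F : Module.End ℝ (S × ι → ℝ) := Gt * (Qcs₁ ∘ₗ Cop₁ ∘ₗ Qc₁) * Gt - G * (Qcs ∘ₗ Cop ∘ₗ Qc) * G with hF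
  have hexp : ∀ a a' : g.Site, 0 ≤ Real.exp (-(r8 * g.dist a a')) := fun _ _ => Real.exp_nonneg _
  -- (1,1): weight 1
  have w11 := word (fun a => g.len a ^ 2) (fun a => g.len a ^ 2) hw2 hw2 hT2 (by rw [one_mul]; exact hG0w) hd0w (by rw [mul_one]; exact hGt0w) he0w
  have hPp : HasL2Majorant (g := toB6 g R H) (fun p : S × ι => blk p.1) F (fun a a' => K * α₁ * Real.exp (-(r8 * g.dist a a'))) := by
    have h : HasL2Majorant (g := toB6 g R H) (fun p : S × ι => blk p.1) F
        (fun a a' => KF * (g.len a ^ 2 * ((g.len a ^ 4)⁻¹ * g.len a ^ 2)) * Real.exp (-(r8 * g.dist a a'))) := by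
      simpa only [one_mul, mul_one, hF] using w11
    refine hasL2Majorant_mono (g := toB6 g R H) _ h fun a a' => ?_
    have ha : g.len a ≠ 0 := (hlen a).ne'
    have e : g.len a ^ 2 * ((g.len a ^ 4)⁻¹ * g.len a ^ 2) = 1 := by field_simp
    rw [e, mul_one]
    exact mul_le_mul_of_nonneg_right hK1 (hexp a a')
  -- (∇_μ, 1): weight ℓ⁻¹, then the direction sum
  have wμ : ∀ μ : κ, HasL2Majorant (g := toB6 g R H) (fun p : S × ι => blk p.1) (conj b (diffLetter T U c' (Sum.inl μ)) * F)
      (fun a a' => KF * (g.len a)⁻¹ * Real.exp (-(r8 * g.dist a a'))) := by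
    intro μ
    have h := word (fun a => g.len a) (fun a => g.len a ^ 2) hw1 hw2 hT2 (hG1w μ) (hd1w μ) (by rw [mul_one]; exact hGt0w) he0w
    have h' : HasL2Majorant (g := toB6 g R H) (fun p : S × ι => blk p.1) (conj b (diffLetter T U c' (Sum.inl μ)) * F)
        (fun a a' => KF * (g.len a * ((g.len a ^ 4)⁻¹ * g.len a ^ 2)) * Real.exp (-(r8 * g.dist a a'))) := by
      simpa only [mul_one, hF] using h
    refine hasL2Majorant_mono (g := toB6 g R H) _ h' fun a a' => le_of_eq ?_
    have ha : g.len a ≠ 0 := (hlen a).ne'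
    have e : g.len a * ((g.len a ^ 4)⁻¹ * g.len a ^ 2) = (g.len a)⁻¹ := by field_simp
    rw [e]
  have hDPp := hasL2MajorantHom_gradLin_comp (R := R) (H := H) b T U blk c' wμ
  -- (1, ∇♯_ν): weight ℓ⁻¹, then the direction sum
  have wν : ∀ ν : κ, HasL2Majorant (g := toB6 g R H) (fun p : S × ι => blk p.1) (F * conj b (diffLetter T U c' (Sum.inr ν)))
      (fun a a' => KF * (g.len a)⁻¹ * Real.exp (-(r8 * g.dist a a'))) := by
    intro ν
    have h := word (fun a => g.len a ^ 2) (fun a => g.len a) hw2 hw1 hT1 (by rw [one_mul]; exact hG0w) hd0w (hGt2w ν) (he2w ν)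
    have h' : HasL2Majorant (g := toB6 g R H) (fun p : S × ι => blk p.1) (F * conj b (diffLetter T U c' (Sum.inr ν)))
        (fun a a' => KF * (g.len a ^ 2 * ((g.len a ^ 4)⁻¹ * g.len a)) * Real.exp (-(r8 * g.dist a a'))) := by
      simpa only [one_mul, hF] using h
    refine hasL2Majorant_mono (g := toB6 g R H) _ h' fun a a' => le_of_eq ?_
    have ha : g.len a ≠ 0 := (hlen a).ne'
    have e : g.len a ^ 2 * ((g.len a ^ 4)⁻¹ * g.len a) = (g.len a)⁻¹ := by field_simp
    rw [e]
  have hKw : ∀ a a' : g.Site, 0 ≤ KF * (g.len a)⁻¹ * Real.exp (-(r8 * g.dist a a')) := fun a a' => by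
    have := inv_nonneg.mpr (hw1 a); positivity
  have hPpDs := hasL2MajorantHom_comp_divLin (R := R) (H := H) b T U blk c' hKw wν
  -- (∇_μ, ∇♯_ν): weight ℓ⁻², then the double direction sum
  have wμν : ∀ μ ν : κ, HasL2Majorant (g := toB6 g R H) (fun p : S × ι => blk p.1)
      (conj b (diffLetter T U c' (Sum.inl μ)) * F * conj b (diffLetter T U c' (Sum.inr ν)))
      (fun a a' => KF * (g.len a ^ 2)⁻¹ * Real.exp (-(r8 * g.dist a a'))) := by
    intro μ ν
    have h := word (fun a => g.len a) (fun a => g.len a) hw1 hw1 hT1 (hG1w μ) (hd1w μ) (hGt2w ν) (he2w ν)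
    have h' : HasL2Majorant (g := toB6 g R H) (fun p : S × ι => blk p.1)
        (conj b (diffLetter T U c' (Sum.inl μ)) * F * conj b (diffLetter T U c' (Sum.inr ν)))
        (fun a a' => KF * (g.len a * ((g.len a ^ 4)⁻¹ * g.len a)) * Real.exp (-(r8 * g.dist a a'))) := by
      simpa only [hF] using h
    refine hasL2Majorant_mono (g := toB6 g R H) _ h' fun a a' => le_of_eq ?_
    have ha : g.len a ≠ 0 := (hlen a).ne'
    have e : g.len a * ((g.len a ^ 4)⁻¹ * g.len a) = (g.len a ^ 2)⁻¹ := by field_simp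
    rw [e]
  have hKw2 : ∀ a a' : g.Site, 0 ≤ KF * (g.len a ^ 2)⁻¹ * Real.exp (-(r8 * g.dist a a')) := fun a a' => by
    have := inv_nonneg.mpr (hw2 a); positivity
  have hDPpDs := hasL2Majorant_gradLin_comp_comp_divLin (R := R) (H := H) b T U blk c' hKw2 wμν
  -- the rate `(21/25)δ = r8` and the common constant `K·α₁`
  have er8 : (21 : ℝ) / 25 * δ = r8 := by rw [hr8]; ring
  rw [er8]
  refine ⟨hPp, ?_, ?_, ?_⟩
  · refine hasL2MajorantHom_mono (g := toB6 g R H) _ _ hDPp fun a a' => ?_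
    have h0 : 0 ≤ (g.len a)⁻¹ * Real.exp (-(r8 * g.dist a a')) := mul_nonneg (inv_nonneg.mpr (hw1 a)) (hexp a a')
    calc Real.sqrt (Fintype.card κ) * (KF * (g.len a)⁻¹ * Real.exp (-(r8 * g.dist a a')))
        = (Real.sqrt (Fintype.card κ) * KF) * ((g.len a)⁻¹ * Real.exp (-(r8 * g.dist a a'))) := by ring
      _ ≤ (K * α₁) * ((g.len a)⁻¹ * Real.exp (-(r8 * g.dist a a'))) := mul_le_mul_of_nonneg_right hKs h0
      _ = _ := by ring
  · refine hasL2MajorantHom_mono (g := toB6 g R H) _ _ hPpDs fun a a' => ?_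
    have h0 : 0 ≤ (g.len a)⁻¹ * Real.exp (-(r8 * g.dist a a')) := mul_nonneg (inv_nonneg.mpr (hw1 a)) (hexp a a')
    calc Real.sqrt (Fintype.card κ) * (KF * (g.len a)⁻¹ * Real.exp (-(r8 * g.dist a a')))
        = (Real.sqrt (Fintype.card κ) * KF) * ((g.len a)⁻¹ * Real.exp (-(r8 * g.dist a a'))) := by ring
      _ ≤ (K * α₁) * ((g.len a)⁻¹ * Real.exp (-(r8 * g.dist a a'))) := mul_le_mul_of_nonneg_right hKs h0
      _ = _ := by ring
  · refine hasL2Majorant_mono (g := toB6 g R H) _ hDPpDs fun a a' => ?_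
    have h0 : 0 ≤ (g.len a ^ 2)⁻¹ * Real.exp (-(r8 * g.dist a a')) := mul_nonneg (inv_nonneg.mpr (hw2 a)) (hexp a a')
    calc (Fintype.card κ : ℝ) * (KF * (g.len a ^ 2)⁻¹ * Real.exp (-(r8 * g.dist a a')))
        = ((Fintype.card κ : ℝ) * KF) * ((g.len a ^ 2)⁻¹ * Real.exp (-(r8 * g.dist a a'))) := by ring
      _ ≤ (K * α₁) * ((g.len a ^ 2)⁻¹ * Real.exp (-(r8 * g.dist a a'))) := mul_le_mul_of_nonneg_right hKc h0
      _ = _ := by ring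

end Assembly

end Literature.MathematicalPhysics.QuantumFieldTheory.Balaban1983to89.B9Ineq368L2FP

end
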